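import Summits.AtomisticToContinuum.FouriersLaw.Theses.BondHeatUncertainty
import Summits.AtomisticToContinuum.FouriersLaw.Theorems.BondHeatUncertaintySubdiffusiveBondHeatGibbsPositionEighthMomentMarginal

/-!
# `N`-uniform eighth moments of the bath-bond positions under the Gibbs state (`stub_gibbsPositionEighthMoment`)

Line `bath-bond-deficit-integral` of crux `BondHeatUncertainty.SubdiffusiveBondHeat`
(item `stmt-AtomisticToContinuum-9120`), registered stub `stub_gibbsPositionEighthMoment`, proved
with exactly the registered signature: for the pinned anharmonic chain
`P = pinnedChain ω₂ lam β γ` (`U(q) = ω₂q²/2 + lam q⁴/4`, `V(r) = r²/2 + βr⁴/4`, all parameters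
`> 0`) and `T > 0` there is `C = C(ω₂, lam, T)` with
`∫ q₀⁸ dμ_T^N ≤ C`, `∫ q₁⁸ dμ_T^N ≤ C` (and integrability) for EVERY `N ≥ 2`, where
`μ_T^N = OscillatorChain.gibbsMeasure P N T = Z⁻¹ e^{-H/T} dq dp`.

**Proof.** `C = ∫ a⁸ e^{-U(a)/T} da / ∫ e^{-U(a)/T} da`, the eighth moment of the ONE-SITE Gibbs
state. The Gibbs density factorises, `e^{-H/T} = e^{-Φ_N(q)/T} e^{-∑p²/(2T)}`
(`hamiltonian_eq_kinetic_add_potential`), so the momenta cancel in the ratio (Tonelli on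
`PhaseSpace N = (Fin N → ℝ) × (Fin N → ℝ)`), and the configurational inequality
`(∫ q_i⁸ e^{-Φ_N/T} dq)(∫ e^{-U/T}) ≤ (∫ a⁸ e^{-U/T})(∫ e^{-Φ_N/T} dq)` for `i = 0, 1` is the
Chebyshev step `lintegral_coord_zero_mul_le` / `lintegral_coord_one_mul_le` of the helper file
`…GibbsPositionEighthMomentMarginal` (transfer recursion + Wintner's lemma + Chebyshev's
covariance inequality, helper file `…GibbsPositionEighthMomentRearrangement`), applied with
`h(a) = a⁸`. Finiteness of the two one-site integrals is Gaussian domination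
(`e^{-U(a)/T} ≤ e^{-ω₂a²/(2T)}`); integrability of `q_i⁸` under `μ_T^N` is READ OFF the same
inequality (its left side is finite), and the real-valued bound follows by `ENNReal.toReal`.
-/

noncomputable section

open MeasureTheory Set
open scoped ENNReal

namespace Summit.AtomisticToContinuum.FouriersLaw.Theorems.SubdiffusiveBondHeat

open Literature.MathematicalPhysics.KineticTheory.HeatConduction

/-! ## One-site facts for the pinned anharmonic chain -/

section OneSite

variable {ω₂ lam β : ℝ}

/-- The pinning potential `ω₂q²/2 + lam q⁴/4` (`ω₂, lam ≥ 0`) is radially non-decreasing.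
[folklore] -/
theorem pinnedChain_U_radMono (hω : 0 ≤ ω₂) (hl : 0 ≤ lam) (γ : ℝ) :
    ∀ ⦃a b : ℝ⦄, |a| ≤ |b| → (pinnedChain ω₂ lam β γ).U a ≤ (pinnedChain ω₂ lam β γ).U b := by
  intro a b h
  have h2 : a ^ 2 ≤ b ^ 2 := sq_le_sq.mpr h
  have h4 : a ^ 4 ≤ b ^ 4 := by nlinarith [sq_nonneg a, sq_nonneg b]
  show ω₂ * a ^ 2 / 2 + lam * a ^ 4 / 4 ≤ ω₂ * b ^ 2 / 2 + lam * b ^ 4 / 4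
  nlinarith [mul_le_mul_of_nonneg_left h2 hω, mul_le_mul_of_nonneg_left h4 hl]

/-- The coupling potential `r²/2 + βr⁴/4` (`β ≥ 0`) is radially non-decreasing. [folklore] -/
theorem pinnedChain_V_radMono (hβ : 0 ≤ β) (ω₂ lam γ : ℝ) :
    ∀ ⦃a b : ℝ⦄, |a| ≤ |b| → (pinnedChain ω₂ lam β γ).V a ≤ (pinnedChain ω₂ lam β γ).V b := by
  intro a b h
  have h2 : a ^ 2 ≤ b ^ 2 := sq_le_sq.mpr h
  have h4 : a ^ 4 ≤ b ^ 4 := by nlinarith [sq_nonneg a, sq_nonneg b]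
  show a ^ 2 / 2 + β * a ^ 4 / 4 ≤ b ^ 2 / 2 + β * b ^ 4 / 4
  nlinarith [mul_le_mul_of_nonneg_left h4 hβ]

/-- `a ↦ a⁸` (in `ℝ≥0∞`) is radially non-decreasing. [folklore] -/
theorem radMono_ofReal_pow_eight :
    ∀ ⦃a b : ℝ⦄, |a| ≤ |b| → ENNReal.ofReal (a ^ 8) ≤ ENNReal.ofReal (b ^ 8) := by
  intro a b h
  refine ENNReal.ofReal_le_ofReal ?_
  have := pow_le_pow_left₀ (abs_nonneg a) h 8
  rwa [Even.pow_abs ⟨4, rfl⟩, Even.pow_abs ⟨4, rfl⟩] at this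

/-- Gaussian domination of the one-site weight: `e^{-U(a)/T} ≤ e^{-(ω₂/(2T)) a²}` for `T > 0`,
`lam ≥ 0`. [folklore] -/
theorem pinnedChain_exp_neg_U_div_le (hl : 0 ≤ lam) (γ : ℝ) {T : ℝ} (hT : 0 < T) (a : ℝ) :
    Real.exp (-(pinnedChain ω₂ lam β γ).U a / T) ≤ Real.exp (-(ω₂ / (2 * T)) * a ^ 2) := by
  refine Real.exp_le_exp.mpr ?_
  show -(ω₂ * a ^ 2 / 2 + lam * a ^ 4 / 4) / T ≤ -(ω₂ / (2 * T)) * a ^ 2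
  rw [div_le_iff₀ hT]
  have h4 : 0 ≤ lam * a ^ 4 / 4 := by positivity
  have e : -(ω₂ / (2 * T)) * a ^ 2 * T = -(ω₂ * a ^ 2 / 2) := by field_simp
  rw [e]
  linarith

/-- The one-site partition function is finite: `∫ e^{-U(a)/T} da < ∞` (`ω₂, T > 0`, `lam ≥ 0`).
[folklore] -/
theorem pinnedChain_lintegral_exp_neg_U_ne_top (hω : 0 < ω₂) (hl : 0 ≤ lam) (γ : ℝ) {T : ℝ}
    (hT : 0 < T) :
    ∫⁻ a, ENNReal.ofReal (Real.exp (-(pinnedChain ω₂ lam β γ).U a / T)) ≠ ⊤ := by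
  have hUc : Continuous (pinnedChain ω₂ lam β γ).U := (pinnedChain_contDiff_U ω₂ lam β γ (n := 0)).continuous
  have hc : Continuous fun a => Real.exp (-(pinnedChain ω₂ lam β γ).U a / T) := by fun_prop
  refine (lintegral_ofReal_ne_top_iff_integrable hc.aestronglyMeasurable
    (ae_of_all _ fun a => (Real.exp_pos _).le)).mpr ?_
  refine (integrable_exp_neg_mul_sq (b := ω₂ / (2 * T)) (by positivity)).mono'
    hc.aestronglyMeasurable (ae_of_all _ fun a => ?_)
  rw [Real.norm_eq_abs, abs_of_pos (Real.exp_pos _)]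
  exact pinnedChain_exp_neg_U_div_le hl γ hT a

/-- The one-site partition function is positive: `∫ e^{-U(a)/T} da ≠ 0`. [folklore] -/
theorem pinnedChain_lintegral_exp_neg_U_ne_zero (ω₂ lam β γ T : ℝ) :
    ∫⁻ a, ENNReal.ofReal (Real.exp (-(pinnedChain ω₂ lam β γ).U a / T)) ≠ 0 := by
  have hUc : Continuous (pinnedChain ω₂ lam β γ).U := (pinnedChain_contDiff_U ω₂ lam β γ (n := 0)).continuous
  refine ((lintegral_pos_iff_support (by fun_prop)).mpr ?_).ne'
  have hs : Function.support (fun a : ℝ =>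
      ENNReal.ofReal (Real.exp (-(pinnedChain ω₂ lam β γ).U a / T))) = Set.univ := by
    ext a
    simp [Real.exp_pos]
  rw [hs]
  exact isOpen_univ.measure_pos volume Set.univ_nonempty

/-- The eighth moment of the one-site weight is finite: `∫ a⁸ e^{-U(a)/T} da < ∞`
(`ω₂, T > 0`, `lam ≥ 0`). [folklore] -/
theorem pinnedChain_lintegral_pow_eight_exp_neg_U_ne_top (hω : 0 < ω₂) (hl : 0 ≤ lam) (γ : ℝ)
    {T : ℝ} (hT : 0 < T) :
    ∫⁻ a, ENNReal.ofReal (a ^ 8) * ENNReal.ofReal (Real.exp (-(pinnedChain ω₂ lam β γ).U a / T)) ≠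
      ⊤ := by
  have hUc : Continuous (pinnedChain ω₂ lam β γ).U := (pinnedChain_contDiff_U ω₂ lam β γ (n := 0)).continuous
  have hc : Continuous fun a : ℝ => a ^ 8 * Real.exp (-(pinnedChain ω₂ lam β γ).U a / T) := by
    fun_prop
  have e : (fun a : ℝ => ENNReal.ofReal (a ^ 8) *
      ENNReal.ofReal (Real.exp (-(pinnedChain ω₂ lam β γ).U a / T))) =
      fun a : ℝ => ENNReal.ofReal (a ^ 8 * Real.exp (-(pinnedChain ω₂ lam β γ).U a / T)) := by
    funext a
    rw [ENNReal.ofReal_mul (by positivity)]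
  rw [e]
  refine (lintegral_ofReal_ne_top_iff_integrable hc.aestronglyMeasurable
    (ae_of_all _ fun a => by positivity)).mpr ?_
  have hg : Integrable fun a : ℝ => a ^ 8 * Real.exp (-(ω₂ / (2 * T)) * a ^ 2) := by
    have := integrable_rpow_mul_exp_neg_mul_sq (b := ω₂ / (2 * T)) (by positivity) (s := 8)
      (by norm_num)
    refine this.congr (ae_of_all _ fun a => ?_)
    simp only
    rw [show (8 : ℝ) = ((8 : ℕ) : ℝ) by norm_num, Real.rpow_natCast]
  refine hg.mono' hc.aestronglyMeasurable (ae_of_all _ fun a => ?_)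
  rw [Real.norm_eq_abs, abs_of_nonneg (by positivity)]
  exact mul_le_mul_of_nonneg_left (pinnedChain_exp_neg_U_div_le hl γ hT a) (by positivity)

end OneSite

/-! ## From the configurational inequality to the Gibbs moment bound -/

/-- **Transfer to phase space.** If for a site `i` the configurational Chebyshev inequality
`(∫ q_i⁸ e^{-Φ_N/T} dq) · B ≤ A · ∫ e^{-Φ_N/T} dq` holds with `A < ∞` and `0 < B < ∞`, then `q_i⁸`
is integrable for the Gibbs state `μ_T^N` of the pinned chain and `∫ q_i⁸ dμ_T^N ≤ A/B`: the
Gibbs density is `e^{-Φ_N(q)/T} · e^{-∑p²/(2T)}`, so by Tonelli both sides pick up the same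
kinetic factor; finiteness of the left side gives integrability, and `ENNReal.toReal` the bound.
[folklore] -/
theorem pinnedChain_integrable_and_moment_le {ω₂ lam β : ℝ} (hω : 0 < ω₂) (hl : 0 ≤ lam)
    (hβ : 0 ≤ β) (γ : ℝ) {T : ℝ} (hT : 0 < T) {N : ℕ} (i : Fin N) {A B : ℝ≥0∞} (hA : A ≠ ⊤)
    (hB0 : B ≠ 0) (hB : B ≠ ⊤)
    (hq : (∫⁻ q : Fin N → ℝ, ENNReal.ofReal ((q i) ^ 8) *
        ENNReal.ofReal (Real.exp (-(pinnedChain ω₂ lam β γ).potential N q / T))) * B ≤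
      A * ∫⁻ q : Fin N → ℝ, ENNReal.ofReal (Real.exp (-(pinnedChain ω₂ lam β γ).potential N q / T))) :
    Integrable (fun z : PhaseSpace N => (z.1 i) ^ 8) ((pinnedChain ω₂ lam β γ).gibbsMeasure N T) ∧
      ∫ z, (z.1 i) ^ 8 ∂((pinnedChain ω₂ lam β γ).gibbsMeasure N T) ≤ A.toReal / B.toReal := by
  set P := pinnedChain ω₂ lam β γ with hP
  have hUc : Continuous P.U := (pinnedChain_contDiff_U ω₂ lam β γ (n := 0)).continuous
  have hVc : Continuous P.V := (pinnedChain_contDiff_V ω₂ lam β γ (n := 0)).continuous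
  have hΦ : Measurable (P.potential N) := (continuous_potential P hUc hVc N).measurable
  have hρc : Continuous (P.gibbsDensity N T) := pinnedChain_continuous_gibbsDensity ω₂ lam β γ N T
  -- the kinetic factor and the factorisation of the Gibbs density
  have hKc : Continuous fun p : Fin N → ℝ => Real.exp (-(∑ j, p j ^ 2 / 2) / T) := by fun_prop
  set K : ℝ≥0∞ := ∫⁻ p : Fin N → ℝ, ENNReal.ofReal (Real.exp (-(∑ j, p j ^ 2 / 2) / T)) with hK
  have hρ : ∀ z : PhaseSpace N, P.gibbsDensity N T z =
      Real.exp (-P.potential N z.1 / T) * Real.exp (-(∑ j, z.2 j ^ 2 / 2) / T) := by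
    intro z
    rw [OscillatorChain.gibbsDensity, P.hamiltonian_eq_kinetic_add_potential, ← Real.exp_add]
    congr 1
    ring
  have hI : ∫⁻ z : PhaseSpace N, ENNReal.ofReal ((z.1 i) ^ 8 * P.gibbsDensity N T z) =
      (∫⁻ q : Fin N → ℝ, ENNReal.ofReal ((q i) ^ 8) *
        ENNReal.ofReal (Real.exp (-P.potential N q / T))) * K := by
    rw [hK, ← lintegral_prod_mul (by fun_prop) hKc.measurable.ennreal_ofReal.aemeasurable]
    refine lintegral_congr fun z => ?_
    rw [hρ, ← mul_assoc, ENNReal.ofReal_mul (by positivity), ENNReal.ofReal_mul (by positivity)]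
  have hZ : ∫⁻ z : PhaseSpace N, ENNReal.ofReal (P.gibbsDensity N T z) =
      (∫⁻ q : Fin N → ℝ, ENNReal.ofReal (Real.exp (-P.potential N q / T))) * K := by
    rw [hK, ← lintegral_prod_mul (by fun_prop) hKc.measurable.ennreal_ofReal.aemeasurable]
    refine lintegral_congr fun z => ?_
    rw [hρ, ENNReal.ofReal_mul (by positivity)]
  -- the phase-space inequality
  have key : (∫⁻ z : PhaseSpace N, ENNReal.ofReal ((z.1 i) ^ 8 * P.gibbsDensity N T z)) * B ≤
      A * ∫⁻ z : PhaseSpace N, ENNReal.ofReal (P.gibbsDensity N T z) := by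
    rw [hI, hZ, mul_right_comm, ← mul_assoc]
    exact mul_le_mul_left hq K
  -- finiteness, integrability
  have hρi : Integrable (P.gibbsDensity N T) := pinnedChain_integrable_gibbsDensity hω hl hβ γ N hT
  have hZfin : ∫⁻ z : PhaseSpace N, ENNReal.ofReal (P.gibbsDensity N T z) ≠ ⊤ :=
    (lintegral_ofReal_ne_top_iff_integrable hρi.aestronglyMeasurable
      (ae_of_all _ fun z => (P.gibbsDensity_pos N T z).le)).mpr hρi
  have hIfin : ∫⁻ z : PhaseSpace N, ENNReal.ofReal ((z.1 i) ^ 8 * P.gibbsDensity N T z) ≠ ⊤ := by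
    intro h
    rw [h, ENNReal.top_mul hB0] at key
    exact absurd key (not_le.mpr (ENNReal.mul_lt_top hA.lt_top hZfin.lt_top))
  have hc : Continuous fun z : PhaseSpace N => (z.1 i) ^ 8 * P.gibbsDensity N T z :=
    (((continuous_apply i).comp continuous_fst).pow 8).mul hρc
  have hnn : ∀ z : PhaseSpace N, 0 ≤ (z.1 i) ^ 8 * P.gibbsDensity N T z := fun z =>
    mul_nonneg (by positivity) (P.gibbsDensity_pos N T z).le
  have hInt : Integrable (fun z : PhaseSpace N => (z.1 i) ^ 8 * P.gibbsDensity N T z) :=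
    (lintegral_ofReal_ne_top_iff_integrable hc.aestronglyMeasurable (ae_of_all _ hnn)).mp hIfin
  refine ⟨P.integrable_gibbsMeasure hInt, ?_⟩
  -- the bound
  rw [P.integral_gibbsMeasure]
  have hZpos : 0 < ∫ z, P.gibbsDensity N T z := integral_exp_pos hρi
  have e1 : ENNReal.ofReal (∫ z : PhaseSpace N, (z.1 i) ^ 8 * P.gibbsDensity N T z) =
      ∫⁻ z : PhaseSpace N, ENNReal.ofReal ((z.1 i) ^ 8 * P.gibbsDensity N T z) :=
    ofReal_integral_eq_lintegral_ofReal hInt (ae_of_all _ hnn)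
  have e2 : ENNReal.ofReal (∫ z, P.gibbsDensity N T z) =
      ∫⁻ z : PhaseSpace N, ENNReal.ofReal (P.gibbsDensity N T z) :=
    ofReal_integral_eq_lintegral_ofReal hρi (ae_of_all _ fun z => (P.gibbsDensity_pos N T z).le)
  have hreal : (∫ z : PhaseSpace N, (z.1 i) ^ 8 * P.gibbsDensity N T z) * B.toReal ≤
      A.toReal * ∫ z, P.gibbsDensity N T z := by
    have := ENNReal.toReal_mono (ENNReal.mul_ne_top hA hZfin) key
    rwa [ENNReal.toReal_mul, ENNReal.toReal_mul, ← e1, ← e2,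
      ENNReal.toReal_ofReal (integral_nonneg hnn), ENNReal.toReal_ofReal hZpos.le] at this
  have hBpos : 0 < B.toReal := ENNReal.toReal_pos hB0 hB
  rw [inv_mul_le_iff₀ hZpos, mul_div_assoc', le_div_iff₀ hBpos]
  linarith [mul_comm A.toReal (∫ z, P.gibbsDensity N T z)]

/-! ## The stub -/

/-- **Stub `stub_gibbsPositionEighthMoment`** (statics, `N`-uniform): uniform eighth moments of
the positions at the two sites of the bath bond under the Gibbs state of the pinned anharmonic
chain: there is `C = C(ω₂, lam, T)` with `∫ q₀⁸ dμ_T^N ≤ C` and `∫ q₁⁸ dμ_T^N ≤ C` (with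
integrability) for every `N ≥ 2`; in fact `C = ∫ a⁸ e^{-U(a)/T} da / ∫ e^{-U(a)/T} da`, the eighth
moment of the one-site Gibbs state (transfer recursion + Wintner's lemma: each one-site
marginal is `e^{-U/T}` times a symmetric unimodal factor; then Chebyshev's covariance
inequality). [folklore] -/
theorem stub_gibbsPositionEighthMoment :
    ∀ ω₂ lam β γ : ℝ, 0 < ω₂ → 0 < lam → 0 < β → 0 < γ → ∀ T : ℝ, 0 < T →
      ∃ C : ℝ, ∀ (N : ℕ) (hN : 1 < N),
        Integrable (fun z : PhaseSpace N => (z.1 ⟨0, Nat.zero_lt_of_lt hN⟩) ^ 8)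
            ((pinnedChain ω₂ lam β γ).gibbsMeasure N T) ∧
        Integrable (fun z : PhaseSpace N => (z.1 ⟨1, hN⟩) ^ 8) ((pinnedChain ω₂ lam β γ).gibbsMeasure N T) ∧
        ∫ z, (z.1 ⟨0, Nat.zero_lt_of_lt hN⟩) ^ 8 ∂((pinnedChain ω₂ lam β γ).gibbsMeasure N T) ≤ C ∧
        ∫ z, (z.1 ⟨1, hN⟩) ^ 8 ∂((pinnedChain ω₂ lam β γ).gibbsMeasure N T) ≤ C := by
  intro ω₂ lam β γ hω hl hβ _hγ T hT
  have hA := pinnedChain_lintegral_pow_eight_exp_neg_U_ne_top (β := β) hω hl.le γ hT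
  have hB := pinnedChain_lintegral_exp_neg_U_ne_top (β := β) hω hl.le γ hT
  have hB0 := pinnedChain_lintegral_exp_neg_U_ne_zero ω₂ lam β γ T
  refine ⟨(∫⁻ a, ENNReal.ofReal (a ^ 8) *
      ENNReal.ofReal (Real.exp (-(pinnedChain ω₂ lam β γ).U a / T))).toReal /
    (∫⁻ a, ENNReal.ofReal (Real.exp (-(pinnedChain ω₂ lam β γ).U a / T))).toReal, fun N hN => ?_⟩
  obtain ⟨n, rfl⟩ : ∃ n, N = n + 2 := ⟨N - 2, by omega⟩
  have hUc : Continuous (pinnedChain ω₂ lam β γ).U :=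
    (pinnedChain_contDiff_U ω₂ lam β γ (n := 0)).continuous
  have hVc : Continuous (pinnedChain ω₂ lam β γ).V :=
    (pinnedChain_contDiff_V ω₂ lam β γ (n := 0)).continuous
  have hU := pinnedChain_U_radMono (β := β) hω.le hl.le γ
  have hV := pinnedChain_V_radMono hβ.le ω₂ lam γ
  have h8m : Measurable fun a : ℝ => ENNReal.ofReal (a ^ 8) := by fun_prop
  have h0 := pinnedChain_integrable_and_moment_le hω hl.le hβ.le γ hT (0 : Fin (n + 2)) hA hB0 hB
    (lintegral_coord_zero_mul_le hUc hVc hU hV hT.le (n + 1) h8m radMono_ofReal_pow_eight)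
  have h1 := pinnedChain_integrable_and_moment_le hω hl.le hβ.le γ hT (1 : Fin (n + 2)) hA hB0 hB
    (lintegral_coord_one_mul_le hUc hVc hU hV hT.le n h8m radMono_ofReal_pow_eight)
  exact ⟨h0.1, h1.1, h0.2, h1.2⟩

end Summit.AtomisticToContinuum.FouriersLaw.Theorems.SubdiffusiveBondHeat
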